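import Mathlib
import Summits.RiemannHypothesis.RiemannHypothesis.Theorems.JensenPolynomialsDefs
import Summits.RiemannHypothesis.RiemannHypothesis.Theses.JensenPolynomials
import Summits.RiemannHypothesis.RiemannHypothesis.Theorems.JensenHermiteSignTest
import Summits.RiemannHypothesis.RiemannHypothesis.Theorems.JensenHermiteExpansion
import Literature.NumberTheory.LFunctions.XiMoments

/-! # JensenSignTestBlueprint — the Hermite expansion lemma at the critical points and at `±B_d`, and the BLUEPRINT
`hermiteSignTestCubic_of_laws₀ : XiDeltaSqPos → HermiteCriticalRatioBound ρ → XiGorttwCoeffSmall ρ → HermiteSignTestCubic` for EVERY table `ρ`: the route item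
`JensenPolynomials.SignTestBlueprintWindow := SignTestBlueprint rhoWinMin`.  RH-FREE, ξ-free glue (the frame identity S-T0 is
`gorttwFrame_holds` of `JensenHermiteExpansion`).  Verbatim port of HOME JensenTargets v4.5 §8.1, §8.6 (cell rh-jensen, D-0040; D-0064(4)).
Closer-ready: `signTestBlueprint_holds ρ : SignTestBlueprint ρ`; item closer `signTestBlueprintWindow_item`.  Nothing here bears on the zeros of `ζ`. -/

noncomputable section
set_option linter.dupNamespace false

open Polynomial Finset
open scoped Nat

namespace Summit.RiemannHypothesis.RiemannHypothesis.Theorems.JensenPolynomials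

open Literature.NumberTheory.LFunctions

/-- `B_d = 2√(2d+1) + 2 > 0`. -/
theorem hermiteTestBound_pos (d : ℕ) : 0 < hermiteTestBound d := by
  unfold hermiteTestBound; positivity

/-- `B_d² ≥ 8d`. -/
theorem hermiteTestBound_sq (d : ℕ) : 8 * (d : ℝ) ≤ hermiteTestBound d ^ 2 := by
  unfold hermiteTestBound
  have hs : 0 ≤ Real.sqrt (2 * d + 1) := Real.sqrt_nonneg _
  have hsq : Real.sqrt (2 * (d : ℝ) + 1) ^ 2 = 2 * d + 1 := Real.sq_sqrt (by positivity)
  nlinarith [hsq, hs]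

/-- Ratio bound beyond the oscillatory region: for `x > 0` with `x² ≥ 8(k + i)`,
`(x/2)^i · H_k(x/2) ≤ H_{k+i}(x/2)` (iterate `gorzHermite_eval_pos_aux`). -/
theorem gorzHermite_eval_ratio_pow (i k : ℕ) {x : ℝ} (hx : 0 < x)
    (hk : 8 * ((k : ℝ) + i) ≤ x ^ 2) :
    (x / 2) ^ i * (gorzHermite k).eval x ≤ (gorzHermite (k + i)).eval x := by
  induction i with
  | zero => simp
  | succ i ih =>
    have hk' : 8 * ((k : ℝ) + i) ≤ x ^ 2 := by push_cast at hk; linarith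
    have h1 := ih hk'
    have h2 := (gorzHermite_eval_pos_aux (k + i) hx (by push_cast at hk ⊢; linarith)).1
    rw [show k + (i + 1) = k + i + 1 from by ring, pow_succ]
    have hx2 : 0 ≤ x / 2 := by positivity
    calc (x / 2) ^ i * (x / 2) * (gorzHermite k).eval x
        = x / 2 * ((x / 2) ^ i * (gorzHermite k).eval x) := by ring
      _ ≤ x / 2 * (gorzHermite (k + i)).eval x := mul_le_mul_of_nonneg_left h1 hx2
      _ ≤ _ := h2

/-- At a zero of `H_{m+1}(X/2)` the next Hermite polynomial does not vanish (interlacing + recurrence). -/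
theorem gorzHermite_eval_ne_zero_of_critical (m : ℕ) {y : ℝ}
    (hy : (gorzHermite (m + 1)).eval y = 0) : (gorzHermite (m + 2)).eval y ≠ 0 := by
  obtain ⟨r, _, hQ, hsign⟩ := gorzHermite_interlaces m
  have hy' : ∃ i, y = r i := by
    rw [hQ, eval_prod, Finset.prod_eq_zero_iff] at hy
    obtain ⟨i, _, hi⟩ := hy
    exact ⟨i, by simpa [sub_eq_zero] using hi⟩
  obtain ⟨i, rfl⟩ := hy'
  have h := hsign i
  rw [gorzHermite_add_two, eval_sub, eval_mul, eval_X, hy, mul_zero, zero_sub, eval_mul, eval_C]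
  intro h0
  have : (gorzHermite m).eval (r i) = 0 := by
    have h2 : (2 : ℝ) * ((m : ℝ) + 1) ≠ 0 := by positivity
    have := neg_eq_zero.1 h0
    rcases mul_eq_zero.1 this with h3 | h3
    · exact absurd (by exact_mod_cast h3) h2
    · exact h3
  rw [this, mul_zero] at h
  exact lt_irrefl _ h

/-- **PROVED (ξ-free glue behind P6's kernel route)**: if the normalised `J̃^{d,n}_γ` has a Hermite expansion
`Σ_j c_j H_{d−j}(X/2)` with `c₀ = 1` whose tail is dominated (a) at every critical point by `|H_d(X/2)|`
and (b) in the weights `(2/B_d)^j`, then the Hermite sign test holds. (a) is where S-H3-type ratio bounds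
and the coefficient majorant enter; (b) uses only `H_{k+1} ≥ (X/2)H_k > 0` beyond `X² ≥ 8k`. -/
theorem hermiteSignTest_of_expansion {γ : ℕ → ℝ} {d n : ℕ} (c : ℕ → ℝ)
    (hframe : gorttwNormalised γ d n = ∑ j ∈ range (d + 1), C (c j) * gorzHermite (d - j))
    (hc0 : c 0 = 1)
    (hcrit : ∀ y : ℝ, (gorzHermite (d - 1)).eval y = 0 →
      ∑ j ∈ range d, |c (j + 1)| * |(gorzHermite (d - (j + 1))).eval y| < |(gorzHermite d).eval y|)
    (hout : ∑ j ∈ range d, |c (j + 1)| * (2 / hermiteTestBound d) ^ (j + 1) < 1) :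
    HermiteSignTest γ d n := by
  set B := hermiteTestBound d with hB
  -- evaluation formula with the head term split off
  have hev : ∀ x, (gorttwNormalised γ d n).eval x = (gorzHermite d).eval x +
      ∑ j ∈ range d, c (j + 1) * (gorzHermite (d - (j + 1))).eval x := by
    intro x
    rw [hframe, eval_finsetSum, sum_range_succ']
    simp only [eval_mul, eval_C, hc0, one_mul, Nat.sub_zero, add_comm]
  -- generic tail bound
  have htail : ∀ x, |∑ j ∈ range d, c (j + 1) * (gorzHermite (d - (j + 1))).eval x| ≤
      ∑ j ∈ range d, |c (j + 1)| * |(gorzHermite (d - (j + 1))).eval x| := by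
    intro x
    refine (abs_sum_le_sum_abs _ _).trans (le_of_eq ?_)
    exact sum_congr rfl fun j _ => abs_mul _ _
  have hBpos : 0 < B := hermiteTestBound_pos d
  have hBsq : 8 * (d : ℝ) ≤ B ^ 2 := hermiteTestBound_sq d
  have hHdpos : 0 < (gorzHermite d).eval B := (gorzHermite_eval_pos_aux d hBpos hBsq).2
  -- ratio bounds at the outer abscissa
  have hratio : ∀ j ∈ range d,
      |(gorzHermite (d - (j + 1))).eval B| ≤ (2 / B) ^ (j + 1) * (gorzHermite d).eval B := by
    intro j hj
    rw [mem_range] at hj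
    have hk : 8 * (((d - (j + 1) : ℕ) : ℝ) + ((j + 1 : ℕ) : ℝ)) ≤ B ^ 2 := by
      rw [← Nat.cast_add, Nat.sub_add_cancel (by omega)]; exact hBsq
    have h1 := gorzHermite_eval_ratio_pow (j + 1) (d - (j + 1)) hBpos hk
    rw [Nat.sub_add_cancel (by omega)] at h1
    have hk0 : 8 * (((d - (j + 1) : ℕ) : ℝ)) ≤ B ^ 2 := by
      have : (0 : ℝ) ≤ ((j + 1 : ℕ) : ℝ) := Nat.cast_nonneg _
      linarith
    have hpos := (gorzHermite_eval_pos_aux (d - (j + 1)) hBpos hk0).2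
    rw [abs_of_pos hpos]
    have hB2 : 0 < (B / 2) ^ (j + 1) := by positivity
    have hinv : (2 / B) ^ (j + 1) = ((B / 2) ^ (j + 1))⁻¹ := by
      rw [← inv_pow, inv_div]
    rw [hinv, ← div_eq_inv_mul, le_div_iff₀ hB2, mul_comm]
    exact h1
  -- the tail at ±B is at most S · H_d(B), S the weighted coefficient sum
  have htailB : ∀ s : ℝ, (s = B ∨ s = -B) →
      |∑ j ∈ range d, c (j + 1) * (gorzHermite (d - (j + 1))).eval s| ≤
        (∑ j ∈ range d, |c (j + 1)| * (2 / B) ^ (j + 1)) * (gorzHermite d).eval B := by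
    intro s hs
    refine (htail s).trans ?_
    rw [sum_mul]
    refine sum_le_sum fun j hj => ?_
    have habs : |(gorzHermite (d - (j + 1))).eval s| = |(gorzHermite (d - (j + 1))).eval B| := by
      rcases hs with rfl | rfl
      · rfl
      · rw [gorzHermite_eval_neg, abs_mul, abs_pow, abs_neg, abs_one, one_pow, one_mul]
    rw [habs, mul_assoc]
    exact mul_le_mul_of_nonneg_left (hratio j hj) (abs_nonneg _)
  have hSlt : (∑ j ∈ range d, |c (j + 1)| * (2 / B) ^ (j + 1)) * (gorzHermite d).eval B <
      (gorzHermite d).eval B := by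
    have := mul_lt_mul_of_pos_right hout hHdpos
    simpa using this
  refine ⟨?_, ?_, ?_⟩
  · intro y hy
    have h1 := hcrit y hy
    have hT := lt_of_le_of_lt (htail y) h1
    set H := (gorzHermite d).eval y
    set T := ∑ j ∈ range d, c (j + 1) * (gorzHermite (d - (j + 1))).eval y
    have hHpos : 0 < |H| := lt_of_le_of_lt (abs_nonneg T) hT
    have hlt : |T| * |H| < |H| * |H| := mul_lt_mul_of_pos_right hT hHpos
    rw [hev y]
    nlinarith [abs_mul_abs_self H, neg_abs_le (T * H), abs_mul T H]
  · rw [hev B]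
    have hS := htailB B (Or.inl rfl)
    linarith [neg_abs_le (∑ j ∈ range d, c (j + 1) * (gorzHermite (d - (j + 1))).eval B)]
  · rw [hev (-B), gorzHermite_eval_neg]
    set T' := ∑ j ∈ range d, c (j + 1) * (gorzHermite (d - (j + 1))).eval (-B)
    have hS := htailB (-B) (Or.inr rfl)
    have hsq : ((-1 : ℝ) ^ d) * ((-1 : ℝ) ^ d) = 1 := by
      rw [← pow_add, ← two_mul, pow_mul]; norm_num
    have hre : (-1 : ℝ) ^ d * ((-1) ^ d * (gorzHermite d).eval B + T') =
        (gorzHermite d).eval B + (-1) ^ d * T' := by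
      linear_combination ((gorzHermite d).eval B) * hsq
    rw [hre]
    have h3 : |(-1 : ℝ) ^ d * T'| ≤
        (∑ j ∈ range d, |c (j + 1)| * (2 / B) ^ (j + 1)) * (gorzHermite d).eval B := by
      rw [abs_mul, abs_pow, abs_neg, abs_one, one_pow, one_mul]; exact hS
    linarith [neg_abs_le ((-1 : ℝ) ^ d * T')]

/-- **PROVED (P6's blueprint, the analogue of `hermiteTuranLawQuartic_of_laws`)**: frame S-T0 + strict
Turán S-T5 + Hermite critical-ratio bounds S-H3 (any table `ρ`) + coefficient smallness S-C (same `ρ`)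
⇒ `HermiteSignTestCubic`; with `splits_of_hermiteSignTestCubic` this is a complete CAL-free kernel route
from four named RH-FREE statements to hyperbolicity of `J^{d,n}_ξ` on `n ≥ 2d³`. -/
theorem hermiteSignTestCubic_of_laws (hF : GorttwFrame xiTaylorCoeff) (hΔ : XiDeltaSqPos)
    {ρ : ℕ → ℕ → ℝ} (hH : HermiteCriticalRatioBound ρ) (hC : XiGorttwCoeffSmall ρ) :
    HermiteSignTestCubic := by
  intro d n hd _ hdn
  have hdn' : 2 * d ^ 3 ≤ n := by simpa using hdn
  have hM : xiTaylorCoeff (n + d) ≠ 0 := (xiTaylorCoeff_pos_holds (n + d)).ne'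
  have hM1 : xiTaylorCoeff (n + d - 1) ≠ 0 := (xiTaylorCoeff_pos_holds (n + d - 1)).ne'
  obtain ⟨h0, -, -, hexp⟩ := hF d n (by omega) (hΔ (n + d) (by omega)) hM hM1
  obtain ⟨hC1, hC2⟩ := hC d n hd hdn'
  refine hermiteSignTest_of_expansion _ hexp h0 ?_ hC2
  intro y hy
  obtain ⟨m, rfl⟩ : ∃ m, d = m + 2 := ⟨d - 2, by omega⟩
  have hne : (gorzHermite (m + 2)).eval y ≠ 0 :=
    gorzHermite_eval_ne_zero_of_critical m (by simpa using hy)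
  have hHpos : 0 < |(gorzHermite (m + 2)).eval y| := abs_pos.2 hne
  calc ∑ j ∈ range (m + 2), |gorttwCoeff xiTaylorCoeff (m + 2) n (j + 1)| *
          |(gorzHermite (m + 2 - (j + 1))).eval y|
      ≤ ∑ j ∈ range (m + 2), |gorttwCoeff xiTaylorCoeff (m + 2) n (j + 1)| *
          (ρ (m + 2) (j + 1) * |(gorzHermite (m + 2)).eval y|) := by
        refine sum_le_sum fun j hj => ?_
        rw [mem_range] at hj
        exact mul_le_mul_of_nonneg_left (hH (m + 2) (j + 1) y (by omega) (by omega) hy) (abs_nonneg _)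
    _ = (∑ j ∈ range (m + 2), |gorttwCoeff xiTaylorCoeff (m + 2) n (j + 1)| * ρ (m + 2) (j + 1)) *
          |(gorzHermite (m + 2)).eval y| := by
        rw [sum_mul]; exact sum_congr rfl fun j _ => by ring
    _ < |(gorzHermite (m + 2)).eval y| := by
        have := mul_lt_mul_of_pos_right hC1 hHpos
        simpa using this
/-- **P6 blueprint with the frame discharged** (`hermiteSignTestCubic_of_laws` ∘ S-T0 `gorttwFrame_holds`): the Hermite
sign-test law at `n ≥ 2d³` follows from S-T5 (`Δ² > 0`, zero-free in print), a Hermite critical-ratio table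
S-H3 and the matching coefficient smallness S-C — three analytic inputs, no bookkeeping hypothesis left. -/
theorem hermiteSignTestCubic_of_laws₀ (hΔ : XiDeltaSqPos) {ρ : ℕ → ℕ → ℝ}
    (hH : HermiteCriticalRatioBound ρ) (hC : XiGorttwCoeffSmall ρ) : HermiteSignTestCubic :=
  hermiteSignTestCubic_of_laws (gorttwFrame_holds xiTaylorCoeff) hΔ hH hC

/-- CLOSER-READY form of the blueprint for every table `ρ` (Defs `SignTestBlueprint`). -/
theorem signTestBlueprint_holds (ρ : ℕ → ℕ → ℝ) : SignTestBlueprint ρ :=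
  fun hΔ hH hC => hermiteSignTestCubic_of_laws₀ hΔ hH hC


/-! ## ITEM CLOSER (route `JensenPolynomials`; the Theses decl is this statement by definition). -/

/-- **Item closer** (route `JensenPolynomials`, item `SignTestBlueprintWindow` = the blueprint at the route's table
`rhoWinMin`): the Theses decl unfolds to `SignTestBlueprint rhoWinMin` (RH-FREE, ξ-free glue). -/
theorem signTestBlueprintWindow_item :
    Summit.RiemannHypothesis.RiemannHypothesis.Theses.JensenPolynomials.SignTestBlueprintWindow :=
  signTestBlueprint_holds rhoWinMin

end Summit.RiemannHypothesis.RiemannHypothesis.Theorems.JensenPolynomials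

end
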